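import Literature.MathematicalPhysics.KineticTheory.CollisionTubePullbackDefs
import Literature.Analysis.FluidPDE.HardSphereTrajectoryMeasurable
import Literature.Analysis.FluidPDE.HardSphereFreeStretch
import HarnessLib

/-!
# The collision-cylinder pull-back along hard-sphere orbits, III: flights of a pair

Trajectory facts for the pull-back (GST 2013 §4.1, Def. 4.1.2): a particle that takes part in no
collision during `(a, b]` flies freely there — across the collisions of the OTHER particles, at which
it does not jump (`apply_eq_translate_of_forall_not_participates`, any geometry with continuous
translations over a Hausdorff position space); along a good orbit on `𝕋³`: positions of such a
particle on the closed interval, constancy of its velocity, the left-limit velocity at the next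
collision, the pre-collisional velocities of a colliding pair as the flight velocities
(`reflectVel_orbit_eq`), and the minimal image following the pair free flight as long as it stays
shorter than `1/2` (`sepAt_orbit_eq`).

## References

* C. Cercignani, R. Illner, M. Pulvirenti, *The Mathematical Theory of Dilute Gases* (1994), §2.2
  (Boltzmann's collision cylinder: the molecules about to hit a given one within time `dt` fill the
  cylinder of height `|V · n| dt` over the protection sphere; pre-collisional hemisphere `V · n < 0`).
  [CIPDiluteGases1994]
* I. Gallagher, L. Saint-Raymond, B. Texier, *From Newton to Boltzmann* (2013), Part II Ch. 4, §4.1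
  (the hard-sphere flow: free flow between collisions, elastic reflection at `|xᵢ − xⱼ| = ε`,
  pre-collisional iff `νⁱʲ · (vᵢ − vⱼ) < 0`; Prop. 4.1.1, Def. 4.1.2). [GallagherSaintRaymondTexier2013]
-/

noncomputable section

open scoped BigOperators Classical InnerProductSpace ENNReal Topology
open Set MeasureTheory Filter Function
open Literature.Analysis.FluidPDE

namespace Literature.MathematicalPhysics.KineticTheory

/-! ## Free flight of a particle that does not collide -/

section ParticleFlight

variable {d : Type*} [Fintype d] {X : Type*} [TopologicalSpace X] {N' : ℕ}
  {G : Geometry d X} {ε : ℝ} {γ : ℝ → Config N' d X}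

/-- On a collision-free window `(a, b]` every particle flies freely. [folklore] -/
theorem apply_eq_translate_of_free (h : IsHardSphereTrajectory G ε N' γ) (k : Fin N') {a b : ℝ}
    (hab : a ≤ b) (hfree : ∀ u ∈ Ioc a b, u ∉ collisionTimes G ε γ) :
    γ b k = (G.translate (γ a k).1 ((b - a) • (γ a k).2), (γ a k).2) := by
  rw [h.free a b hab hfree, freeFlight_apply]

/-- **A particle that takes part in no collision during `(a, b]` flies freely on `[a, b]`**:
`γ b k = (x_k(a) + (b − a) v_k(a), v_k(a))` (induction on the finitely many collision times in
`(a, b]`: at each of them the left limit is the free flight and the non-participating particle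
does not jump). [folklore] -/
theorem apply_eq_translate_of_forall_not_participates [T2Space X] (h : IsHardSphereTrajectory G ε N' γ)
    (hG : ∀ x : X, Continuous (G.translate x)) (k : Fin N') {a b : ℝ} (hab : a ≤ b)
    (hk : ∀ u ∈ Ioc a b, ¬ Participates G ε (γ u) k) :
    γ b k = (G.translate (γ a k).1 ((b - a) • (γ a k).2), (γ a k).2) := by
  suffices H : ∀ (n : ℕ) (a : ℝ), a ≤ b → (collisionTimes G ε γ ∩ Ioc a b).ncard ≤ n →
      (∀ u ∈ Ioc a b, ¬ Participates G ε (γ u) k) →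
      γ b k = (G.translate (γ a k).1 ((b - a) • (γ a k).2), (γ a k).2) from
    H _ a hab le_rfl hk
  intro n
  induction n with
  | zero =>
    intro a hab hcard hk
    have hfin : (collisionTimes G ε γ ∩ Ioc a b).Finite :=
      h.finite_collisionTimes_inter_of_subset_Icc Ioc_subset_Icc_self
    have hemp : collisionTimes G ε γ ∩ Ioc a b = ∅ :=
      (Set.ncard_eq_zero hfin).1 (Nat.le_zero.1 hcard)
    exact apply_eq_translate_of_free h k hab fun u hu hcol => by
      have : u ∈ collisionTimes G ε γ ∩ Ioc a b := ⟨hcol, hu⟩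
      rw [hemp] at this
      exact this
  | succ n IH =>
    intro a hab hcard hk
    have hfin : (collisionTimes G ε γ ∩ Ioc a b).Finite :=
      h.finite_collisionTimes_inter_of_subset_Icc Ioc_subset_Icc_self
    by_cases hemp : collisionTimes G ε γ ∩ Ioc a b = ∅
    · exact apply_eq_translate_of_free h k hab fun u hu hcol => by
        have : u ∈ collisionTimes G ε γ ∩ Ioc a b := ⟨hcol, hu⟩
        rw [hemp] at this
        exact this
    -- the first collision time `τ ∈ (a, b]`
    have hne : hfin.toFinset.Nonempty := by
      rw [Set.Finite.toFinset_nonempty]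
      exact Set.nonempty_iff_ne_empty.2 hemp
    set τ := hfin.toFinset.min' hne with hτdef
    have hτmem : τ ∈ collisionTimes G ε γ ∩ Ioc a b := (Set.Finite.mem_toFinset hfin).1 (hfin.toFinset.min'_mem hne)
    have hτmin : ∀ s ∈ collisionTimes G ε γ ∩ Ioc a b, τ ≤ s := fun s hs =>
      hfin.toFinset.min'_le s ((Set.Finite.mem_toFinset hfin).2 hs)
    have haτ : a < τ := hτmem.2.1
    have hτb : τ ≤ b := hτmem.2.2
    have hfree : ∀ u ∈ Ioo a τ, u ∉ collisionTimes G ε γ := fun u hu hcol =>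
      (not_le.2 hu.2) (hτmin u ⟨hcol, hu.1, hu.2.le.trans hτb⟩)
    -- the colliding pair at `τ` does not contain `k`
    obtain ⟨p, q, hpq, hc⟩ := hτmem.1
    obtain ⟨-, zl, hzl, -, heq⟩ := h.binary τ p q hpq hc
    have hpart : ¬ Participates G ε (γ τ) k := hk τ hτmem.2
    have hkp : k ≠ p := by
      rintro rfl
      exact hpart ⟨q, Or.inl (mem_contactPairs.2 ⟨hpq, hc⟩)⟩
    have hkq : k ≠ q := by
      rintro rfl
      exact hpart ⟨p, Or.inr (mem_contactPairs.2 ⟨hpq, hc⟩)⟩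
    -- the value of particle `k` at `τ` is the free-flight value
    have hτk : γ τ k = (G.translate (γ a k).1 ((τ - a) • (γ a k).2), (γ a k).2) := by
      rw [heq, collidePair_apply_of_ne hkp hkq]
      have hev : Continuous fun z : Config N' d X => z k := continuous_apply k
      have h1 : Tendsto (fun u => γ u k) (𝓝[<] τ) (𝓝 (zl k)) := (hev.tendsto zl).comp hzl
      have hc2 : Continuous fun u : ℝ => (G.translate (γ a k).1 ((u - a) • (γ a k).2), (γ a k).2) :=
        ((hG _).comp ((continuous_id.sub continuous_const).smul continuous_const)).prodMk
          continuous_const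
      have h2 : Tendsto (fun u => γ u k) (𝓝[<] τ)
          (𝓝 (G.translate (γ a k).1 ((τ - a) • (γ a k).2), (γ a k).2)) := by
        refine ((hc2.tendsto τ).mono_left nhdsWithin_le_nhds).congr' ?_
        filter_upwards [Ioo_mem_nhdsLT haτ] with u hu
        rw [h.free a u hu.1.le fun s hs => hfree s ⟨hs.1, hs.2.trans_lt hu.2⟩, freeFlight_apply]
      exact tendsto_nhds_unique h1 h2
    -- induction from `τ`
    have hcard' : (collisionTimes G ε γ ∩ Ioc τ b).ncard ≤ n := by
      have hss : collisionTimes G ε γ ∩ Ioc τ b ⊂ collisionTimes G ε γ ∩ Ioc a b := by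
        refine ⟨fun s hs => ⟨hs.1, haτ.trans hs.2.1, hs.2.2⟩, fun hsub => ?_⟩
        exact (lt_irrefl τ) (hsub hτmem).2.1
      have := Set.ncard_lt_ncard hss hfin
      omega
    have hk' : ∀ u ∈ Ioc τ b, ¬ Participates G ε (γ u) k := fun u hu =>
      hk u ⟨haτ.trans hu.1, hu.2⟩
    rw [IH τ hτb hcard' hk', hτk, G.translate_add, ← add_smul]
    congr 2
    ring

end ParticleFlight

/-! ## Good orbits on the torus: flights of a pair between its collisions -/

section Orbit

variable {σ : ℝ} {N : ℕ} {Φ : HardSphereFlow (Torus.geometry (Fin 3)) (hsDiameter σ N) (N + 1)}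
  {z : Config (N + 1) (Fin 3) T3}

/-- A good orbit is a hard-sphere trajectory. [folklore] -/
theorem isTraj (hz : z ∈ Φ.good) :
    IsHardSphereTrajectory (Torus.geometry (Fin 3)) (hsDiameter σ N) (N + 1) (orbit σ N Φ z) :=
  Φ.isTrajectory z hz

/-- A good orbit starts at its initial datum. [folklore] -/
theorem orbit_zero (hz : z ∈ Φ.good) : orbit σ N Φ z 0 = z :=
  Φ.flow_zero z hz

/-- A good orbit is Borel measurable in time. [folklore] -/
theorem measurable_orbit (hz : z ∈ Φ.good) : Measurable (orbit σ N Φ z) :=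
  (isTraj hz).measurable_torus

/-- A good orbit stays in the hard-sphere domain. [folklore] -/
theorem orbit_mem (hz : z ∈ Φ.good) (s : ℝ) :
    orbit σ N Φ z s ∈ hardSphereDomain (Torus.geometry (Fin 3)) (N + 1) (hsDiameter σ N) :=
  (isTraj hz).mem s

/-- **A particle with no collision in `(a, b]` flies freely on the torus**:
`γ b k = (x_k(a) + proj((b − a) v_k(a)), v_k(a))`. [folklore] -/
theorem orbit_apply_eq_of_forall_not_participates (hz : z ∈ Φ.good) (k : Fin (N + 1)) {a b : ℝ}
    (hab : a ≤ b)
    (hk : ∀ u ∈ Ioc a b, ¬ Participates (Torus.geometry (Fin 3)) (hsDiameter σ N) (orbit σ N Φ z u) k) :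
    orbit σ N Φ z b k =
      ((orbit σ N Φ z a k).1 + Literature.Analysis.FunctionSpaces.Torus.proj ((b - a) • (orbit σ N Φ z a k).2),
        (orbit σ N Φ z a k).2) :=
  apply_eq_translate_of_forall_not_participates (isTraj hz) Torus.continuous_geometry_translate k hab hk

/-- **Positions of a particle with no collision in the OPEN interval `(a, b)`** are the free-flight
positions on the CLOSED interval `[a, b]` (positions are continuous). [folklore] -/
theorem orbit_pos_eq_of_forall_not_participates (hz : z ∈ Φ.good) (k : Fin (N + 1)) {a b : ℝ}
    (hab : a ≤ b)
    (hk : ∀ u ∈ Ioo a b, ¬ Participates (Torus.geometry (Fin 3)) (hsDiameter σ N) (orbit σ N Φ z u) k)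
    {t : ℝ} (ht : t ∈ Icc a b) :
    (orbit σ N Φ z t k).1 =
      (orbit σ N Φ z a k).1 + Literature.Analysis.FunctionSpaces.Torus.proj ((t - a) • (orbit σ N Φ z a k).2) := by
  rcases ht.2.lt_or_eq with htb | rfl
  · rw [orbit_apply_eq_of_forall_not_participates hz k ht.1 fun u hu => hk u ⟨hu.1, hu.2.trans_lt htb⟩]
  · rcases hab.lt_or_eq with hab' | rfl
    · -- continuity of positions at `b` from the left
      have h1 : Tendsto (fun u => (orbit σ N Φ z u k).1) (𝓝[<] t) (𝓝 (orbit σ N Φ z t k).1) :=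
        (((isTraj hz).pos_continuous k).tendsto t).mono_left nhdsWithin_le_nhds
      have hc2 : Continuous fun u : ℝ =>
          (orbit σ N Φ z a k).1 + Literature.Analysis.FunctionSpaces.Torus.proj ((u - a) • (orbit σ N Φ z a k).2) :=
        continuous_const.add (Literature.Analysis.FunctionSpaces.Torus.continuous_proj.comp
          ((continuous_id.sub continuous_const).smul continuous_const))
      have h2 : Tendsto (fun u => (orbit σ N Φ z u k).1) (𝓝[<] t)
          (𝓝 ((orbit σ N Φ z a k).1 +
            Literature.Analysis.FunctionSpaces.Torus.proj ((t - a) • (orbit σ N Φ z a k).2))) := by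
        refine ((hc2.tendsto t).mono_left nhdsWithin_le_nhds).congr' ?_
        filter_upwards [Ioo_mem_nhdsLT hab'] with u hu
        rw [orbit_apply_eq_of_forall_not_participates hz k hu.1.le fun s hs =>
          hk s ⟨hs.1, hs.2.trans_lt hu.2⟩]
      exact tendsto_nhds_unique h1 h2
    · simp

/-- **Velocities of a particle with no collision in `(a, b)`** are constant on `[a, b)`. [folklore] -/
theorem orbit_vel_eq_of_forall_not_participates (hz : z ∈ Φ.good) (k : Fin (N + 1)) {a b : ℝ}
    (hk : ∀ u ∈ Ioo a b, ¬ Participates (Torus.geometry (Fin 3)) (hsDiameter σ N) (orbit σ N Φ z u) k)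
    {t : ℝ} (ht : t ∈ Ico a b) :
    (orbit σ N Φ z t k).2 = (orbit σ N Φ z a k).2 := by
  rw [orbit_apply_eq_of_forall_not_participates hz k ht.1 fun u hu => hk u ⟨hu.1, hu.2.trans_lt ht.2⟩]

/-- **The left-limit velocity at `b` of a particle with no collision in `(a, b)`** is its velocity
at `a` (`a < b`). [folklore] -/
theorem leftLim_orbit_vel_eq (hz : z ∈ Φ.good) (k : Fin (N + 1)) {a b : ℝ} (hab : a < b)
    (hk : ∀ u ∈ Ioo a b, ¬ Participates (Torus.geometry (Fin 3)) (hsDiameter σ N) (orbit σ N Φ z u) k) :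
    (Function.leftLim (orbit σ N Φ z) b k).2 = (orbit σ N Φ z a k).2 := by
  have hev : Continuous fun ζ : Config (N + 1) (Fin 3) T3 => (ζ k).2 := (continuous_apply k).snd
  have h1 : Tendsto (fun u => (orbit σ N Φ z u k).2) (𝓝[<] b) (𝓝 (Function.leftLim (orbit σ N Φ z) b k).2) :=
    (hev.tendsto _).comp ((isTraj hz).tendsto_leftLim Torus.continuous_geometry_translate b)
  have h2 : Tendsto (fun u => (orbit σ N Φ z u k).2) (𝓝[<] b) (𝓝 (orbit σ N Φ z a k).2) := by
    refine tendsto_const_nhds.congr' ?_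
    filter_upwards [Ioo_mem_nhdsLT hab] with u hu
    rw [orbit_vel_eq_of_forall_not_participates hz k hk ⟨hu.1.le, hu.2⟩]
  exact tendsto_nhds_unique h1 h2

/-- **Pre-collisional velocities are the flight velocities.**  At a collision `b` of the ordered
pair `(i, j)` preceded by flights of `i` and `j` free on `(a, b)` (`a < b`), the pre-collisional
velocities recovered by `reflectVel` are the velocities at time `a`. [folklore] -/
theorem reflectVel_orbit_eq (hz : z ∈ Φ.good) {i j : Fin (N + 1)} {a b : ℝ} (hab : a < b)
    (hi : ∀ u ∈ Ioo a b, ¬ Participates (Torus.geometry (Fin 3)) (hsDiameter σ N) (orbit σ N Φ z u) i)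
    (hj : ∀ u ∈ Ioo a b, ¬ Participates (Torus.geometry (Fin 3)) (hsDiameter σ N) (orbit σ N Φ z u) j)
    (hp : (i, j) ∈ contactPairs (Torus.geometry (Fin 3)) (hsDiameter σ N) (orbit σ N Φ z b)) :
    reflectVel (sepAt (orbit σ N Φ z b) i j) ((orbit σ N Φ z b i).2, (orbit σ N Φ z b j).2) =
      ((orbit σ N Φ z a i).2, (orbit σ N Φ z a j).2) := by
  have h := (isTraj hz).ofConfig_preVel_eq_leftLim hp
  rw [HardSphereCollisionRecord.ofConfig_preVel] at h
  change reflectVel (sepAt (orbit σ N Φ z b) i j) _ = _ at h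
  rw [h, leftLim_orbit_vel_eq hz i hab hi, leftLim_orbit_vel_eq hz j hab hj]

end Orbit

section PairStretch

variable {σ : ℝ} {N : ℕ} {Φ : HardSphereFlow (Torus.geometry (Fin 3)) (hsDiameter σ N) (N + 1)}
  {z : Config (N + 1) (Fin 3) T3}

/-- **Position difference of a freely flying pair.**  If `i` and `j` take part in no collision
during `(a, b)`, then for `t ∈ [a, b]` the difference of their positions is that at time `a`
translated by `proj ((t − a) w)`, `w = vᵢ(a) − vⱼ(a)`. [folklore] -/
theorem orbit_posDiff_eq (hz : z ∈ Φ.good) {i j : Fin (N + 1)} {a b : ℝ} (hab : a ≤ b)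
    (hi : ∀ u ∈ Ioo a b, ¬ Participates (Torus.geometry (Fin 3)) (hsDiameter σ N) (orbit σ N Φ z u) i)
    (hj : ∀ u ∈ Ioo a b, ¬ Participates (Torus.geometry (Fin 3)) (hsDiameter σ N) (orbit σ N Φ z u) j)
    {t : ℝ} (ht : t ∈ Icc a b) :
    (orbit σ N Φ z t i).1 - (orbit σ N Φ z t j).1 =
      ((orbit σ N Φ z a i).1 - (orbit σ N Φ z a j).1) +
        Literature.Analysis.FunctionSpaces.Torus.proj ((t - a) • relVel (orbit σ N Φ z a) i j) := by
  rw [orbit_pos_eq_of_forall_not_participates hz i hab hi ht,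
    orbit_pos_eq_of_forall_not_participates hz j hab hj ht, relVel, smul_sub, sub_eq_add_neg (_ • _),
    Literature.Analysis.FunctionSpaces.Torus.proj_add, Literature.Analysis.FunctionSpaces.Torus.proj_neg]
  abel

/-- **The minimal image follows the pair free flight** as long as it stays small: for
`t, t' ∈ [a, b]` with `‖q(t) + (t' − t) w‖ < 1/2`, `q(t') = q(t) + (t' − t) w`. [folklore] -/
theorem sepAt_orbit_eq (hz : z ∈ Φ.good) {i j : Fin (N + 1)} {a b : ℝ} (hab : a ≤ b)
    (hi : ∀ u ∈ Ioo a b, ¬ Participates (Torus.geometry (Fin 3)) (hsDiameter σ N) (orbit σ N Φ z u) i)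
    (hj : ∀ u ∈ Ioo a b, ¬ Participates (Torus.geometry (Fin 3)) (hsDiameter σ N) (orbit σ N Φ z u) j)
    {t t' : ℝ} (ht : t ∈ Icc a b) (ht' : t' ∈ Icc a b)
    (hsmall : ‖sepAt (orbit σ N Φ z t) i j + (t' - t) • relVel (orbit σ N Φ z a) i j‖ < 1 / 2) :
    sepAt (orbit σ N Φ z t') i j = sepAt (orbit σ N Φ z t) i j + (t' - t) • relVel (orbit σ N Φ z a) i j := by
  have hX : (orbit σ N Φ z t' i).1 - (orbit σ N Φ z t' j).1 =
      ((orbit σ N Φ z t i).1 - (orbit σ N Φ z t j).1) +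
        Literature.Analysis.FunctionSpaces.Torus.proj ((t' - t) • relVel (orbit σ N Φ z a) i j) := by
    rw [orbit_posDiff_eq hz hab hi hj ht', orbit_posDiff_eq hz hab hi hj ht, add_assoc,
      ← Literature.Analysis.FunctionSpaces.Torus.proj_add, ← add_smul]
    congr 3
    ring
  unfold sepAt at hsmall ⊢
  rw [Torus.geometry_sepVec] at hsmall ⊢
  rw [Torus.geometry_sepVec, hX]
  exact reprSym_add_proj_of_norm_lt hsmall

/-- Velocities of a freely flying pair: `relVel (γ t) i j = relVel (γ a) i j` on `[a, b)`, and the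
individual velocities are those at `a`. [folklore] -/
theorem orbit_vels_eq (hz : z ∈ Φ.good) {i j : Fin (N + 1)} {a b : ℝ}
    (hi : ∀ u ∈ Ioo a b, ¬ Participates (Torus.geometry (Fin 3)) (hsDiameter σ N) (orbit σ N Φ z u) i)
    (hj : ∀ u ∈ Ioo a b, ¬ Participates (Torus.geometry (Fin 3)) (hsDiameter σ N) (orbit σ N Φ z u) j)
    {t : ℝ} (ht : t ∈ Ico a b) :
    (orbit σ N Φ z t i).2 = (orbit σ N Φ z a i).2 ∧ (orbit σ N Φ z t j).2 = (orbit σ N Φ z a j).2 ∧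
      relVel (orbit σ N Φ z t) i j = relVel (orbit σ N Φ z a) i j := by
  have h1 := orbit_vel_eq_of_forall_not_participates hz i hi ht
  have h2 := orbit_vel_eq_of_forall_not_participates hz j hj ht
  exact ⟨h1, h2, by rw [relVel, relVel, h1, h2]⟩

/-- Inside a stretch free of collisions of `i`, the pair `(i, j)` is never at contact. [folklore] -/
theorem norm_sepAt_ne_of_not_participates (hz : z ∈ Φ.good) {i j : Fin (N + 1)} (hij : i ≠ j)
    {u : ℝ} (hi : ¬ Participates (Torus.geometry (Fin 3)) (hsDiameter σ N) (orbit σ N Φ z u) i) :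
    ‖sepAt (orbit σ N Φ z u) i j‖ ≠ hsDiameter σ N := by
  intro hcontact
  refine hi ⟨j, Or.inl ?_⟩
  exact (mem_contactPairs_iff_of_mem (orbit_mem hz u)).2 ⟨hij, hcontact⟩

end PairStretch

end Literature.MathematicalPhysics.KineticTheory

end
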